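import Literature.Analysis.FluidPDE.TypeIAncientMild
import Literature.Analysis.FluidPDE.SpaceTimeCalculus
import HarnessLib

/-!
# `ScarRigidity` — line `SketchIdeator6` (skeleton v2), stub `stub_selfSimilar_of_scalingGeneratorZero` (P3)
# (crux stmt-NavierStokesRegularity-11717, route RellichScar)

**P3 — a vanishing scaling generator forces exact self-similarity.**
Let `V : ℝ → ℝ³ → ℝ³` be jointly `C^∞` on the open backward slab `(−∞,0) × ℝ³` (the smoothness member of
`IsTypeIAncientMild C V`; nothing else of the class is used) and suppose its scaling generator vanishes there,
`z(t,x) := V(t,x) + ∇V(t,x)·x + 2t ∂ₜV(t,x) = 0` for `t < 0`.  Then `V` is invariant under every parabolic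
rescaling: `λ V(λ²t, λx) = V(t,x)` for `λ > 0`, `t < 0`, i.e. `nsRescale λ V t x = V t x`.

Proof.  Fix `t < 0`, `x`.  The curve `F(μ) := μ V(μ²t, μx)` (`μ > 0`) is differentiable with
`F'(μ) = V(μ²t,μx) + μ · D(uncurry V)(μ²t, μx)(2μt, x)` (chain rule through the joint Fréchet derivative along
`μ ↦ (μ²t, μx)`, product rule).  Splitting the joint derivative into the time partial `D(1,0) = ∂ₜV` and the
space partial `D(0,a) = ∇V·a` (the tree's `IsSmoothSpaceTimeOn.deriv_timeLine`,
`IsSmoothSpaceTimeOn.fderiv_slice_apply_of_isOpen`) gives `F'(μ) = z(μ²t, μx) = 0`.  By the mean value inequality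
on the convex set `(0,∞)` with bound `0`, `F(λ) = F(1) = V(t,x)`.  Mathlib only.
-/

noncomputable section

open Set Filter Function MeasureTheory Metric TopologicalSpace
open scoped Topology ENNReal NNReal InnerProductSpace RealInnerProductSpace

set_option linter.dupNamespace false

namespace Summit.NavierStokesRegularity.NavierStokesRegularity.Theorems.RellichScarScarRigidity

open Literature.Analysis.FluidPDE

/-- Physical space. -/
local notation "ℝ³" => EuclideanSpace ℝ (Fin 3)

/-- The scale curve `μ ↦ (μ²t, μ•x)` in space–time has derivative `(2μt, x)` at `μ`. [folklore] -/
private theorem hasDerivAt_scaleCurve (t : ℝ) (x : ℝ³) (μ : ℝ) :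
    HasDerivAt (fun ν : ℝ => ((ν ^ 2 * t, ν • x) : ℝ × ℝ³)) ((2 * μ * t, x) : ℝ × ℝ³) μ := by
  have h1 : HasDerivAt (fun ν : ℝ => ν ^ 2 * t) (2 * μ * t) μ := by
    have h := (hasDerivAt_pow 2 μ).mul_const t
    refine h.congr_deriv ?_
    push_cast
    ring
  have h2 : HasDerivAt (fun ν : ℝ => ν • x) x μ := by
    simpa using (hasDerivAt_id μ).smul_const x
  exact h1.prodMk h2

/-- **Derivative of the zoom orbit in the scale parameter.**  For a field jointly smooth on the open backward
slab, the curve `μ ↦ μ V(μ²t, μx)` (`t < 0`) has derivative at `μ > 0` equal to the generator-type expression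
`V(s,y) + ∇V(s,y)·y + (2s) ∂ₜV(s,y)` evaluated at the rescaled point `(s,y) = (μ²t, μx)` (chain rule through
the joint derivative, split into its time and space partials). [folklore] -/
private theorem hasDerivAt_zoomOrbit {V : ℝ → ℝ³ → ℝ³} (hsm : IsSmoothSpaceTimeOn (Iio (0 : ℝ)) V)
    {t : ℝ} (ht : t < 0) (x : ℝ³) {μ : ℝ} (hμ : 0 < μ) :
    HasDerivAt (fun ν : ℝ => ν • V (ν ^ 2 * t) (ν • x))
      (V (μ ^ 2 * t) (μ • x) + fderiv ℝ (V (μ ^ 2 * t)) (μ • x) (μ • x)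
        + (2 * (μ ^ 2 * t)) • deriv (fun s => V s (μ • x)) (μ ^ 2 * t)) μ := by
  -- the rescaled point lies in the open slab
  have hst : μ ^ 2 * t < 0 := mul_neg_of_pos_of_neg (pow_pos hμ 2) ht
  -- joint differentiability there
  have hdiff : DifferentiableAt ℝ (uncurry V) ((μ ^ 2 * t, μ • x) : ℝ × ℝ³) :=
    (hsm.contDiffAt isOpen_Iio hst (μ • x)).differentiableAt (by simp)
  set D : ℝ × ℝ³ →L[ℝ] ℝ³ := fderiv ℝ (uncurry V) ((μ ^ 2 * t, μ • x) : ℝ × ℝ³) with hD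
  -- chain rule along the scale curve
  have hcomp : HasDerivAt (fun ν : ℝ => V (ν ^ 2 * t) (ν • x)) (D ((2 * μ * t, x) : ℝ × ℝ³)) μ := by
    have h := hdiff.hasFDerivAt.comp_hasDerivAt μ (hasDerivAt_scaleCurve t x μ)
    have h3 : (uncurry V ∘ fun ν : ℝ => ((ν ^ 2 * t, ν • x) : ℝ × ℝ³)) =
        fun ν : ℝ => V (ν ^ 2 * t) (ν • x) := rfl
    rw [h3] at h
    exact h
  -- product rule with the scalar factor `ν`
  have hprod : HasDerivAt (fun ν : ℝ => ν • V (ν ^ 2 * t) (ν • x))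
      (μ • D ((2 * μ * t, x) : ℝ × ℝ³) + (1 : ℝ) • V (μ ^ 2 * t) (μ • x)) μ :=
    (hasDerivAt_id' μ).smul hcomp
  refine hprod.congr_deriv ?_
  -- split the joint derivative into its time and space partials
  have hvec : ((2 * μ * t, x) : ℝ × ℝ³) = (2 * μ * t) • ((1, 0) : ℝ × ℝ³) + ((0, x) : ℝ × ℝ³) := by
    ext <;> simp
  have htime : D ((1, 0) : ℝ × ℝ³) = deriv (fun s => V s (μ • x)) (μ ^ 2 * t) := by
    rw [hD, hsm.deriv_timeLine isOpen_Iio hst (μ • x)]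
  have hspace : D ((0, x) : ℝ × ℝ³) = fderiv ℝ (V (μ ^ 2 * t)) (μ • x) x := by
    rw [hD, hsm.fderiv_slice_apply_of_isOpen isOpen_Iio hst (μ • x) x]
  have hsx : fderiv ℝ (V (μ ^ 2 * t)) (μ • x) (μ • x) = μ • fderiv ℝ (V (μ ^ 2 * t)) (μ • x) x :=
    (fderiv ℝ (V (μ ^ 2 * t)) (μ • x)).map_smul μ x
  rw [hvec, map_add, map_smul, htime, hspace, hsx, one_smul, smul_add, smul_smul,
    show μ * (2 * μ * t) = 2 * (μ ^ 2 * t) by ring]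
  abel

/-- **P3 — vanishing scaling generator ⇒ exact self-similarity.**  A field jointly smooth on the open backward
slab (`IsTypeIAncientMild`, smoothness member) whose scaling generator `V + x·∇V + 2t∂ₜV` vanishes there is
invariant under every parabolic rescaling: `λV(λ²t,λx) = V(t,x)` for `λ > 0` (the scale derivative of the zoom
orbit is the rescaled generator, hence zero; mean value inequality on `(0,∞)`). [folklore] -/
theorem stub_selfSimilar_of_scalingGeneratorZero :
    ∀ (V : ℝ → ℝ³ → ℝ³) (C : ℝ), IsTypeIAncientMild C V →
      (∀ t < 0, ∀ x : ℝ³, V t x + fderiv ℝ (V t) x x + (2 * t) • deriv (fun s => V s x) t = 0) →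
      ∀ lam : ℝ, 0 < lam → ∀ t < 0, ∀ x : ℝ³, nsRescale lam V t x = V t x := by
  intro V C hm hz lam hlam t ht x
  have hsm : IsSmoothSpaceTimeOn (Iio (0 : ℝ)) V := hm.contDiffOn
  -- the zoom orbit has vanishing scale derivative on `(0, ∞)`
  have hF : ∀ μ ∈ Ioi (0 : ℝ), HasDerivWithinAt (fun ν : ℝ => ν • V (ν ^ 2 * t) (ν • x))
      ((fun _ : ℝ => (0 : ℝ³)) μ) (Ioi (0 : ℝ)) μ := by
    intro μ hμ
    have hμ0 : 0 < μ := hμ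
    have hst : μ ^ 2 * t < 0 := mul_neg_of_pos_of_neg (pow_pos hμ0 2) ht
    have h := hasDerivAt_zoomOrbit hsm ht x hμ0
    rw [hz (μ ^ 2 * t) hst (μ • x)] at h
    exact h.hasDerivWithinAt
  have hbound : ∀ μ ∈ Ioi (0 : ℝ), ‖(fun _ : ℝ => (0 : ℝ³)) μ‖ ≤ 0 := fun μ _ => by simp
  -- mean value inequality with bound `0` between `1` and `lam`
  have hmvt := (convex_Ioi (0 : ℝ)).norm_image_sub_le_of_norm_hasDerivWithin_le hF hbound
    (mem_Ioi.2 one_pos) (mem_Ioi.2 hlam)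
  rw [zero_mul, norm_le_zero_iff, sub_eq_zero] at hmvt
  rw [nsRescale_apply, hmvt]
  simp

end Summit.NavierStokesRegularity.NavierStokesRegularity.Theorems.RellichScarScarRigidity

end
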